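import Literature.AnabelianGeometry.AbsoluteAnabelian.AbsTopIChainsIsoCompat
import HarnessLib

/-!
# [AbsTopI] Def 4.2 (iii): elementary operations respect the extension structure
# `1 → Δⱼ → Πⱼ → Gⱼ → 1` — base groups and geometric parts along a `Π`-chain (proof-only)

S. Mochizuki, *Topics in Absolute Anabelian Geometry I: Generalities* (2012) [AbsTopI] §4, Def 4.2
(iii) pp. 49–50 (manuscript pagination, lit key `paper:url-11ac98ba15fc`).  By (1_Π)–(2_Π) every term
`Πⱼ` of a `Π`-chain carries the extension `1 → Δⱼ → Πⱼ → Gⱼ → 1`, `Gⱼ ⊆ G` open, and by (a)–(d) the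
operation homomorphisms are compatible with the rigidifying homomorphisms.  For `G` slim (standing
hypothesis, p. 47 l. 8), `AbsTopIChainsRigidity.lean` showed that every such operation homomorphism
`φ` lies over `G`.  Consequences recorded here (our kernel check; the print uses them tacitly, e.g.
the scheme-side (1_X) "`Xⱼ → Spec(kⱼ)` … `kⱼ ⊆ k̃` a finite extension of `k`", p. 47, whose group
side is the chain of open subgroups `Gⱼ ⊆ G`):

* `RigCompat.comap_geomJ_eq`: `φ⁻¹(Δⱼ₊₁) = Δⱼ` — the geometric parts CORRESPOND under `φ`; for
  surjective `φ` (types `•`, `⊚`) `φ(Δⱼ) = Δⱼ₊₁` (`map_geomJ_eq_of_surjective`) and `Gⱼ₊₁ = Gⱼ`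
  (`range_proj_eq_of_surjective`): de-cuspidalisation and de-orbification do not change the base
  group;
* per operation type ([AbsTopI] Def 4.2 (iii) (a)–(d), `IsElemOp`): `⋏` (finite étale covering,
  `Πⱼ₊₁ ↪ Πⱼ`) shrinks the base group `Gⱼ₊₁ ⊆ Gⱼ`, `⋎` (finite étale quotient) enlarges it
  `Gⱼ ⊆ Gⱼ₊₁`, `•` and `⊚` preserve it;
* along an object of `DLoc(Π) = Chain^{trm}(Π){⋏, •}` (Def 4.2 (v)) the base groups DECREASE:
  `Gⱼ₊₁ ⊆ Gⱼ` (`PiChain.range_proj_succ_subset_of_isDLocObj`).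

Proof-only (no `def`); the typer's file `AbsTopIChains.lean` is imported, not edited.  Nothing here
bears on [IUTchIII] Cor 3.12; no side is taken.
-/

noncomputable section

open Topology
open scoped Pointwise

universe u

namespace Literature.AnabelianGeometry.AbsoluteAnabelian

open Literature.AlgebraicGeometry.Frobenioids (IsSlimGroup)

namespace FundamentalExtension

variable {E : FundamentalExtension.{u}}

namespace ChainGroup

/-! ### The geometric parts correspond under a rigidification-compatible homomorphism -/

/-- For `G` slim and `φ : Πⱼ → Πⱼ₊₁` compatible with the rigidifying homomorphisms:
`φ⁻¹(Δⱼ₊₁) = Δⱼ` (both are the kernel of the common composite to `G`).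
[cite: MochizukiAbsTopI2012, Def 4.2 (iii) p.49] -/
theorem RigCompat.comap_geomJ_eq (hG : IsSlimGroup E.gal) {L L' : E.ChainGroup}
    {φ : L.grp →ₜ* L'.grp} (h : RigCompat L L' φ) : L'.geomJ.comap φ.toMonoidHom = L.geomJ := by
  ext y
  rw [Subgroup.mem_comap]
  change L'.proj (φ y) = 1 ↔ L.proj y = 1
  rw [h.proj_comp_apply hG]

/-- For `G` slim and a SURJECTIVE rigidification-compatible `φ : Πⱼ ↠ Πⱼ₊₁` (types `•`, `⊚`):
`φ(Δⱼ) = Δⱼ₊₁`. [cite: MochizukiAbsTopI2012, Def 4.2 (iii) p.50] -/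
theorem RigCompat.map_geomJ_eq_of_surjective (hG : IsSlimGroup E.gal) {L L' : E.ChainGroup}
    {φ : L.grp →ₜ* L'.grp} (h : RigCompat L L' φ) (hφ : Function.Surjective φ) :
    L.geomJ.map φ.toMonoidHom = L'.geomJ := by
  refine le_antisymm (h.map_geomJ_le hG) ?_
  intro y' hy'
  obtain ⟨y, rfl⟩ := hφ y'
  refine ⟨y, ?_, rfl⟩
  change L.proj y = 1
  rw [← h.proj_comp_apply hG y]
  exact hy'

/-- For `G` slim and a SURJECTIVE rigidification-compatible `φ : Πⱼ ↠ Πⱼ₊₁` (types `•`, `⊚`): the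
base groups coincide, `Gⱼ₊₁ = Gⱼ` — de-cuspidalisation and de-orbification do not change the base.
[cite: MochizukiAbsTopI2012, Def 4.2 (iii) p.50] -/
theorem RigCompat.range_proj_eq_of_surjective (hG : IsSlimGroup E.gal) {L L' : E.ChainGroup}
    {φ : L.grp →ₜ* L'.grp} (h : RigCompat L L' φ) (hφ : Function.Surjective φ) :
    Set.range L'.proj = Set.range L.proj := by
  refine Set.Subset.antisymm ?_ (h.range_proj_subset hG)
  rintro _ ⟨y', rfl⟩
  obtain ⟨y, rfl⟩ := hφ y'
  exact ⟨y, (h.proj_comp_apply hG y).symm⟩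

/-! ### Per operation type ([AbsTopI] Def 4.2 (iii) (a)–(d)) -/

/-- Type `⋏` (finite étale covering, open immersion `Πⱼ₊₁ ↪ Πⱼ`): the base group shrinks,
`Gⱼ₊₁ ⊆ Gⱼ` (for `G` slim). [cite: MochizukiAbsTopI2012, Def 4.2 (iii) p.50] -/
theorem IsElemOp.range_proj_subset_of_finEtCov (hG : IsSlimGroup E.gal) {C : CuspidalData E}
    {L L' : E.ChainGroup} (h : IsElemOp C .finEtCov L L') :
    Set.range L'.proj ⊆ Set.range L.proj := by
  obtain ⟨φ, -, -, hφ⟩ := h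
  exact hφ.range_proj_subset hG

/-- Type `⋎` (finite étale quotient, open immersion `Πⱼ ↪ Πⱼ₊₁`): the base group grows,
`Gⱼ ⊆ Gⱼ₊₁` (for `G` slim). [cite: MochizukiAbsTopI2012, Def 4.2 (iii) p.50] -/
theorem IsElemOp.range_proj_subset_of_finEtQuot (hG : IsSlimGroup E.gal) {C : CuspidalData E}
    {L L' : E.ChainGroup} (h : IsElemOp C .finEtQuot L L') :
    Set.range L.proj ⊆ Set.range L'.proj := by
  obtain ⟨φ, -, -, hφ⟩ := h
  exact hφ.range_proj_subset hG

/-- Type `•` (de-cuspidalisation, `Πⱼ ↠ Πⱼ₊₁`): the base group is unchanged, `Gⱼ₊₁ = Gⱼ` (for `G`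
slim). [cite: MochizukiAbsTopI2012, Def 4.2 (iii) p.50] -/
theorem IsElemOp.range_proj_eq_of_deCusp (hG : IsSlimGroup E.gal) {C : CuspidalData E}
    {L L' : E.ChainGroup} (h : IsElemOp C .deCusp L L') :
    Set.range L'.proj = Set.range L.proj := by
  obtain ⟨φ, hsurj, hφ, -⟩ := h
  exact hφ.range_proj_eq_of_surjective hG hsurj

/-- Type `⊚` (de-orbification, `Πⱼ ↠ Πⱼ₊₁`): the base group is unchanged, `Gⱼ₊₁ = Gⱼ` (for `G`
slim). [cite: MochizukiAbsTopI2012, Def 4.2 (iii) p.50] -/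
theorem IsElemOp.range_proj_eq_of_deOrb (hG : IsSlimGroup E.gal) {C : CuspidalData E}
    {L L' : E.ChainGroup} (h : IsElemOp C .deOrb L L') :
    Set.range L'.proj = Set.range L.proj := by
  obtain ⟨φ, hsurj, hφ, -⟩ := h
  exact hφ.range_proj_eq_of_surjective hG hsurj

/-- Types `•` and `⊚`: the geometric part of the target is the image of the geometric part of the
source, `Δⱼ₊₁ = φ(Δⱼ)` for the (unique, `RigCompat.unique_of_surjective`) operation surjection
(for `G` slim). [cite: MochizukiAbsTopI2012, Def 4.2 (iii) p.50] -/
theorem IsElemOp.exists_map_geomJ_eq_of_deCusp (hG : IsSlimGroup E.gal) {C : CuspidalData E}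
    {L L' : E.ChainGroup} (h : IsElemOp C .deCusp L L') :
    ∃ φ : L.grp →ₜ* L'.grp, Function.Surjective φ ∧ RigCompat L L' φ ∧
      L.geomJ.map φ.toMonoidHom = L'.geomJ := by
  obtain ⟨φ, hsurj, hφ, -⟩ := h
  exact ⟨φ, hsurj, hφ, hφ.map_geomJ_eq_of_surjective hG hsurj⟩

/-- Type `⊚` analogue of `IsElemOp.exists_map_geomJ_eq_of_deCusp`.
[cite: MochizukiAbsTopI2012, Def 4.2 (iii) p.50] -/
theorem IsElemOp.exists_map_geomJ_eq_of_deOrb (hG : IsSlimGroup E.gal) {C : CuspidalData E}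
    {L L' : E.ChainGroup} (h : IsElemOp C .deOrb L L') :
    ∃ φ : L.grp →ₜ* L'.grp, Function.Surjective φ ∧ RigCompat L L' φ ∧
      L.geomJ.map φ.toMonoidHom = L'.geomJ := by
  obtain ⟨φ, hsurj, hφ, -⟩ := h
  exact ⟨φ, hsurj, hφ, hφ.map_geomJ_eq_of_surjective hG hsurj⟩

end ChainGroup

/-! ### Along a `DLoc(Π)`-chain the base groups decrease -/

namespace PiChain

variable {C : CuspidalData E} {hP : IsSlimGroup E.arith} {hΔ : IsSlimGroup E.geom} {hne : E.geom ≠ ⊥}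

/-- Along an object of `DLoc(Π) = Chain^{trm}(Π){⋏, •}` ([AbsTopI] Def 4.2 (v)) each step shrinks
or preserves the base group: `Gⱼ₊₁ ⊆ Gⱼ` (for `G` slim; `⋏` shrinks, `•` preserves).
[cite: MochizukiAbsTopI2012, Def 4.2 (v) p.51] -/
theorem range_proj_succ_subset_of_isDLocObj (hG : IsSlimGroup E.gal) (c : E.PiChain C hP hΔ hne)
    (hc : c.IsDLocObj) (j : Fin c.len) :
    Set.range (c.term j.succ).proj ⊆ Set.range (c.term j.castSucc).proj := by
  have hop := c.isElemOp j
  rcases Set.mem_insert_iff.1 (hc j) with h | h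
  · rw [h] at hop
    exact hop.range_proj_subset_of_finEtCov hG
  · rw [Set.mem_singleton_iff] at h
    rw [h] at hop
    exact (hop.range_proj_eq_of_deCusp hG).subset

/-- Hence along a `DLoc(Π)`-chain the base groups form a decreasing sequence: `Gⱼ ⊆ Gᵢ` for
`i ≤ j`. [cite: MochizukiAbsTopI2012, Def 4.2 (v) p.51] -/
theorem range_proj_antitone_of_isDLocObj (hG : IsSlimGroup E.gal) (c : E.PiChain C hP hΔ hne)
    (hc : c.IsDLocObj) {i j : Fin (c.len + 1)} (hij : i ≤ j) :
    Set.range (c.term j).proj ⊆ Set.range (c.term i).proj := by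
  -- induction on the difference `j - i`
  obtain ⟨i, hi⟩ := i
  obtain ⟨j, hj⟩ := j
  change i ≤ j at hij
  obtain ⟨d, rfl⟩ := Nat.exists_eq_add_of_le hij
  induction d with
  | zero => exact subset_rfl
  | succ d ih =>
    have hd : i + d < c.len + 1 := by omega
    have hstep := c.range_proj_succ_subset_of_isDLocObj hG hc ⟨i + d, by omega⟩
    have e1 : (⟨i + d, by omega⟩ : Fin c.len).succ = ⟨i + (d + 1), hj⟩ := by
      ext; simp [Nat.add_assoc]
    have e2 : (⟨i + d, by omega⟩ : Fin c.len).castSucc = ⟨i + d, hd⟩ := rfl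
    rw [e1, e2] at hstep
    exact hstep.trans (ih hd (by omega))

end PiChain

end FundamentalExtension

end Literature.AnabelianGeometry.AbsoluteAnabelian

end
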